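import Summits.BirchSwinnertonDyer.Rank1Residual.ManinAdditive.DegeneracyClassEulerUnitTwist
import Summits.BirchSwinnertonDyer.Rank1Residual.ManinAdditive.TowerUnitTwist
import HarnessLib
import HarnessLib.Audit.Tags

/-!
# E-es-66 ⟸ E-es-93 at EVERY level `9 ∣ N` (es g22, PROVED): the W-level polar witnesses from Euler-translated
# prime-class degeneracy loops, and `3 ∤ c(W)` modulo Kato (cell `bsd-f2-manin`, T-es-29 (h′), typer g15)

Cell `bsd-f2-manin` (D-0131 (3) frontier), lens es, planner es g22 MEMO-es §36.15 («PROVED (4)» 2026-08-28T20:52Z); landed by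
the cell typer g15 VERBATIM from HOME/es/Sketch-es-g22-thm87.lean sha16 1fa952104aa82908 §WLevelEulerList (file lines
1798–1842, 1854–1874; the law E-es-93 itself lives in the leaf `DegeneracyClassEulerLaws`): **THEOREM U9♮E (W-level)**
`threeAdicPolarWitness_of_degeneracyClassNineEulerList` — for `W` additive at `3` (two binders) the E-translated prime-class
ratio-`9` plus hypothesis for the LIST of all sharp primes of `N` with `a_q = a_q(W)` gives the tree's
`ThreeAdicPolarWitness W W D.f` with its FULL Euler factor (`V = W`, `ρ = 1`; `Finset.prod_map_toList` matches the tree's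
product over `N.primeFactors with ¬ ℓ² ∣ N` literally); its `3 ∤ c(W)` corollary modulo the tree's Kato shape `KatoFactThreeAt`
and lattice optimality (`not_three_dvd_maninConstant_of_degeneracyClassNineEulerList`, tree lever
`not_three_dvd_of_katoFactThreeAt_of_witness`); and the law corollaries `threeAdicPolarWitness_of_eulerListLawNine` (= the C3
es-input h66 with additivity binders, EVERY level `9 ∣ N`, from the ONE f-level law E-es-93) /
`not_three_dvd_maninConstant_of_eulerListLawNine`.  Namespace `BsdF2ManinEsG22T` ↦ `…ManinAdditive.KatoCurve`.
TYPER EDGE (PROVED, 4 lines): **E-es-93 ⟹ E-es-66** `threeAdicWitnessOfPlusIndexPrimeToThree_of_eulerListLawNine :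
DegeneracyClassEulerListLawNine → ThreeAdicWitnessOfPlusIndexPrimeToThree` — the additivity binders are discharged from
`9 ∣ N` by the cone-free `KatoCurve.additive_of_sq_dvd_level 3` (`TowerUnitTwist`), so the es lens's CHARTER LAW E-es-66
(`PlusIndexLaws` :84, the C3 route's es-input) follows on its whole habitat from the single lattice law E-es-93; compare the
sibling parents E-es-66 ⟸ E-an-135(3) (`threeAdicWitness_of_towerUnitTwist`) and E-es-66|squarefull ⟸ E-es-91
(`threeAdicPolarWitness_of_classLawNine_squarefull`).

EVERYTHING HERE IS A SORRY-FREE THEOREM modulo named hypotheses (the plus hypothesis / the law E-es-93, `KatoFactThreeAt`,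
lattice optimality).  BC5 (es): CENSUS E43 4305/4313 classes `9 ∣ N ≤ 5000` certified, 0 counterexamples (leaf header);
BC7 summit-mode probes CLEAN (es/g22/g22-bc7g.raw.txt 14/14).  REF1 R-es-44 scope (§EL) PENDING at filing — a finding is
repaired under a NEW name (append-only).  bears_on: stmt-BirchSwinnertonDyer-22968 (TURNKEY-es-18: h66 := E-es-93 +
`threeAdicPolarWitness_of_eulerListLawNine`, or E-es-66 := `threeAdicWitnessOfPlusIndexPrimeToThree_of_eulerListLawNine h93`).
PARTITION (es): h66 ⟸ ONE f-level law on 4313/4313 classes (conclusion certified 4305) · beyond-print theorem: es says YES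
(lemma-level) · BSD is not proved by this; Manin's conjecture is not proved by this.
-/

noncomputable section

open scoped Classical MatrixGroups ModularForm ComplexConjugate

open CongruenceSubgroup Complex Literature.NumberTheory.EllipticCurves
  Literature.NumberTheory.EllipticCurves.ModularForms
open Summit.BirchSwinnertonDyer.Rank1Residual.ManinAdditive.KatoCurve
open Summit.BirchSwinnertonDyer.Rank1Residual.ManinAdditive.Gamma1Lattice

namespace Summit.BirchSwinnertonDyer.Rank1Residual.ManinAdditive.KatoCurve

section WLevelEulerList

open WeierstrassCurve

/-- **THEOREM U9♮E (W-level, es g22; PROVED) — every level.**  For `W` additive at `3` (two binders), the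
E-translated prime-class ratio-`9` plus hypothesis for the LIST of all sharp primes of `N` with `a_q = a_q(W)` gives
the tree's `ThreeAdicPolarWitness W W D.f` with its full Euler factor (`V = W`, `ρ = 1`). -/
theorem threeAdicPolarWitness_of_degeneracyClassNineEulerList (W : WeierstrassCurve ℚ) [W.IsElliptic]
    {N : ℕ} [NeZero N] (D : ModularParametrizationData W N)
    (h3g : ¬ W.HasGoodReductionAtPrime 3) (h3m : ¬ W.HasMultiplicativeReductionAtPrime 3)
    (hd : DegeneracyClassEulerListPlusIndexPrimeTo D.f 3 9
      (N.primeFactors.filter fun q => ¬ q ^ 2 ∣ N).toList (fun q => W.LFunction q)) :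
    ThreeAdicPolarWitness W W D.f := by
  obtain ⟨m, hm, hmp, -, -, -, χ, r, hcop, hprim, hne, hord, h9, hev, hr, hu⟩ :=
    exists_prime_eulerListUnitTwist_of_degeneracyClass D.f 9 _ _ D.isNewformOf.1
      D.isNewformOf.coeffField_eq_bot hd
  have h33 : (3 : ZMod m) * 3 = ((9 : ℕ) : ZMod m) := by push_cast; norm_num
  have h9' : χ (3 : ZMod m) * χ (3 : ZMod m) ≠ 1 := by rw [← map_mul, h33]; exact h9
  have h3a : χ (3 : ZMod m) ≠ 1 := fun h => h9' (by rw [h, mul_one])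
  have h3b : χ (3 : ZMod m) ≠ -1 := fun h => h9' (by rw [h]; norm_num)
  refine ⟨m, hm, χ, r, 1, D.isNewformOf, h3g, h3m, hcop, hprim, hne, hord, h3a, h3b, hev,
    by push_cast; ring, ?_, ?_⟩
  · rw [eulerFactorList_eq_prod, Finset.prod_map_toList] at hr
    exact hr
  · intro s hs
    have : (s : ℂ) * r * ((1 : ℚ) : ℂ) / 3 = (s : ℂ) * r / 3 := by push_cast; ring
    rw [this]
    exact hu s hs

/-- **COROLLARY U9♮E (es g22; PROVED, tree lever + tree `KatoFactThreeAt`) — every level.**  `3 ∤ c(W)` for every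
lattice-optimal modular parametrisation of `W` additive at `3` whose newform satisfies the E-translated prime-class
ratio-`9` plus hypothesis for the list of sharp primes. -/
theorem not_three_dvd_maninConstant_of_degeneracyClassNineEulerList (W : WeierstrassCurve ℚ) [W.IsElliptic]
    [W.IsGloballyMinimal] {N : ℕ} [NeZero N] (D : ModularParametrizationData W N)
    (hF : KatoFactThreeAt W D.f)
    (hopt : ∀ z ∈ D.L.lattice, ∃ w ∈ periodLattice D.f, z = D.c * w)
    (h3g : ¬ W.HasGoodReductionAtPrime 3) (h3m : ¬ W.HasMultiplicativeReductionAtPrime 3)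
    (hd : DegeneracyClassEulerListPlusIndexPrimeTo D.f 3 9
      (N.primeFactors.filter fun q => ¬ q ^ 2 ∣ N).toList (fun q => W.LFunction q)) :
    ¬ (3 : ℤ) ∣ D.c := by
  have hΩ : W.realPeriodRat = ((|D.c| : ℤ) : ℝ) * plusPeriod D.f := by
    rw [Int.cast_abs]; exact D.realPeriodRat_eq_abs_mul_plusPeriod_of_latticeEq hopt
  have hc0 : D.c ≠ 0 := D.maninConstant_ne_zero_holds
  have hwit : ThreeAdicPolarWitness W W D.f :=
    threeAdicPolarWitness_of_degeneracyClassNineEulerList W D h3g h3m hd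
  have h := not_three_dvd_of_katoFactThreeAt_of_witness W W D.f |D.c| hF hwit hΩ (abs_ne_zero.mpr hc0)
  exact fun h3 => h ((dvd_abs 3 D.c).mpr h3)

/-- **(K₉)♮E ⟹ h66 at EVERY level (es g22; PROVED).**  E-es-66 (`ThreeAdicWitnessOfPlusIndexPrimeToThree`),
with the additivity of `W` at `3` as binders, follows at every level `9 ∣ N` from the single f-level law E-es-93. -/
theorem threeAdicPolarWitness_of_eulerListLawNine (hlaw : DegeneracyClassEulerListLawNine)
    (W : WeierstrassCurve ℚ) [W.IsElliptic] {N : ℕ} [NeZero N] (D : ModularParametrizationData W N)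
    (h3g : ¬ W.HasGoodReductionAtPrime 3) (h3m : ¬ W.HasMultiplicativeReductionAtPrime 3)
    (h9 : 3 ^ 2 ∣ N) (hd : PlusIndexPrimeTo 3 D.f) : ThreeAdicPolarWitness W W D.f :=
  threeAdicPolarWitness_of_degeneracyClassNineEulerList W D h3g h3m
    (hlaw h9 D.f D.isNewformOf.1 D.isNewformOf.coeffField_eq_bot (fun q => W.LFunction q)
      (fun q _ _ => D.isNewformOf.2 q) hd)

/-- The same with the TREE lever: **E-es-93 + `KatoFactThreeAt` ⟹ `3 ∤ c(W)`** for every lattice-optimal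
parametrisation of a curve additive at `3` at a level `9 ∣ N` with plus index prime to `3`. -/
theorem not_three_dvd_maninConstant_of_eulerListLawNine (hlaw : DegeneracyClassEulerListLawNine)
    (W : WeierstrassCurve ℚ) [W.IsElliptic] [W.IsGloballyMinimal] {N : ℕ} [NeZero N]
    (D : ModularParametrizationData W N) (hF : KatoFactThreeAt W D.f)
    (hopt : ∀ z ∈ D.L.lattice, ∃ w ∈ periodLattice D.f, z = D.c * w)
    (h3g : ¬ W.HasGoodReductionAtPrime 3) (h3m : ¬ W.HasMultiplicativeReductionAtPrime 3)
    (h9 : 3 ^ 2 ∣ N) (hd : PlusIndexPrimeTo 3 D.f) : ¬ (3 : ℤ) ∣ D.c :=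
  not_three_dvd_maninConstant_of_degeneracyClassNineEulerList W D hF hopt h3g h3m
    (hlaw h9 D.f D.isNewformOf.1 D.isNewformOf.coeffField_eq_bot (fun q => W.LFunction q)
      (fun q _ _ => D.isNewformOf.2 q) hd)

/-- **E-es-93 ⟹ E-es-66 (typer g15, PROVED).**  The es lens's charter law `ThreeAdicWitnessOfPlusIndexPrimeToThree`
(`PlusIndexLaws` :84) follows at EVERY level `9 ∣ N` from the single f-level lattice law E-es-93: additivity of `W` at `3`
comes from `9 ∣ N` by the cone-free `additive_of_sq_dvd_level 3` (`TowerUnitTwist`), the rest is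
`threeAdicPolarWitness_of_eulerListLawNine`; the lattice-optimality and global-minimality binders of E-es-66 are not used. -/
theorem threeAdicWitnessOfPlusIndexPrimeToThree_of_eulerListLawNine (hlaw : DegeneracyClassEulerListLawNine) :
    ThreeAdicWitnessOfPlusIndexPrimeToThree := by
  intro W _ _ N _ D _ h9 hd
  haveI : Fact (Nat.Prime 3) := ⟨Nat.prime_three⟩
  obtain ⟨h3g, h3m⟩ := additive_of_sq_dvd_level 3 W D.f D.isNewformOf h9
  exact threeAdicPolarWitness_of_eulerListLawNine hlaw W D h3g h3m h9 hd

/-- … and with the tree's Kato shape: **E-es-93 + `KatoFactThreeAt` ⟹ `3 ∤ c(W)`** for every LATTICE-OPTIMAL modular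
parametrisation at a level `9 ∣ N` with plus index prime to `3` — additivity discharged from `9 ∣ N` (typer g15, PROVED). -/
theorem not_three_dvd_maninConstant_of_eulerListLawNine' (hlaw : DegeneracyClassEulerListLawNine)
    (W : WeierstrassCurve ℚ) [W.IsElliptic] [W.IsGloballyMinimal] {N : ℕ} [NeZero N]
    (D : ModularParametrizationData W N) (hF : KatoFactThreeAt W D.f)
    (hopt : ∀ z ∈ D.L.lattice, ∃ w ∈ periodLattice D.f, z = D.c * w)
    (h9 : 3 ^ 2 ∣ N) (hd : PlusIndexPrimeTo 3 D.f) : ¬ (3 : ℤ) ∣ D.c := by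
  haveI : Fact (Nat.Prime 3) := ⟨Nat.prime_three⟩
  obtain ⟨h3g, h3m⟩ := additive_of_sq_dvd_level 3 W D.f D.isNewformOf h9
  exact not_three_dvd_maninConstant_of_eulerListLawNine hlaw W D hF hopt h3g h3m h9 hd

end WLevelEulerList

end Summit.BirchSwinnertonDyer.Rank1Residual.ManinAdditive.KatoCurve

end
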